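import Summits.ResolutionOfSingularities.ResolutionOfSingularities.Theses.PAlteration
import Summits.ResolutionOfSingularities.ResolutionOfSingularities.Theorems.PAlterationPialtStubRRStability
import Summits.ResolutionOfSingularities.ResolutionOfSingularities.Theorems.PAlterationPialtReductions
import Summits.ResolutionOfSingularities.ResolutionOfSingularities.Theorems.PAlterationPialtKnownCases
import Summits.ResolutionOfSingularities.ResolutionOfSingularities.Theorems.PAlterationPialtRadicialCover
import Summits.ResolutionOfSingularities.ResolutionOfSingularities.Theorems.PAlterationPialtNormalizationIn
import Summits.ResolutionOfSingularities.ResolutionOfSingularities.Theorems.PAlterationPialtNormalizationInConverse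
import Summits.ResolutionOfSingularities.ResolutionOfSingularities.Theorems.PAlterationAssemblyLevels
import Literature.AlgebraicGeometry.Resolution.NormalizationInNormal
import Literature.AlgebraicGeometry.Resolution.ProperModelsPatching
import Literature.AlgebraicGeometry.Resolution.ProperModelsPatchingOfResolution
import Literature.AlgebraicGeometry.Resolution.ProperModelsExtension
import Literature.AlgebraicGeometry.Resolution.SandwichedWeakPatching
import Literature.AlgebraicGeometry.Resolution.FiniteCoverCompactification
import Literature.AlgebraicGeometry.Morphisms.NagataCompactification
import Literature.AlgebraicGeometry.Motives.FunctionFieldOver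
import Mathlib.FieldTheory.PurelyInseparable.PerfectClosure
import Mathlib.FieldTheory.IsAlgClosed.AlgebraicClosure
import HarnessLib

/-!
# STUB-PLAN sketch — `stub_radicialPatching` (crux `Pialt`, stmt-ResolutionOfSingularities-0555)

Stub-critic scratch file (planner-scrit-stmt-ResolutionOfSingularities-0555-stub_radicialP-0):
the helper-lemma STATEMENTS of the merged plan `STUB-PLAN-stub_radicialPatching.md`, sorried,
plus the SORRY-FREE calibrations (H0) and the SORRY-FREE final composition
`stub_radicialPatching_of_atoms` (modulo the sorried helpers), so that the plan is certified to
compose into the stub's literal signature. Not a skeleton; nothing here is registered.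
-/

set_option linter.dupNamespace false
set_option linter.unusedVariables false

noncomputable section

open CategoryTheory CategoryTheory.Limits AlgebraicGeometry TopologicalSpace
open Literature.AlgebraicGeometry Literature.AlgebraicGeometry.Resolution
open Literature.AlgebraicGeometry.Morphisms (NagataCompactification)
open Literature.AlgebraicGeometry.Motives (FunctionFieldOver)
open Summit.ResolutionOfSingularities.ResolutionOfSingularities.Theses.PAlteration (Pialt Picover)
open Summit.ResolutionOfSingularities.ResolutionOfSingularities.Theorems

namespace Summit.ResolutionOfSingularities.ResolutionOfSingularities.Cruxes.Pialt.StubPlanRadicialPatching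

/-! ## Vocabulary (verbatim sub-shapes of the stub signature) -/

/-- the stub's conclusion = the conclusion of the crux at `Z` -/
def PialtAt (Z : Scheme.{0}) : Prop :=
  ∃ (Z' : Scheme.{0}) (g : Z' ⟶ Z), IsProper g ∧ IsIntegral Z' ∧ Scheme.IsRegular Z' ∧
    Function.Surjective g.base ∧ ∃ U : Z.Opens, Dense (U : Set Z) ∧ IsFinite (g ∣_ U) ∧
      UniversallyInjective (g ∣_ U)

/-- radicially regular -/
def RR (Z : Scheme.{0}) : Prop :=
  ∃ (W : Scheme.{0}) (h : W ⟶ Z), IsIntegral W ∧ Scheme.IsRegular W ∧ IsFinite h ∧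
    UniversallyInjective h ∧ Function.Surjective h.base

/-- the stub's `hN` -/
def Normal (Z : Scheme.{0}) : Prop := ∀ z : Z, IsIntegrallyClosed (Z.presheaf.stalk z)

/-- A PICOVER CHART over `k`: a scheme dominated-from-above description is replaced by the
binder block of the route's crux `Picover` — `O` is a finite, universally injective, surjective
cover of SOME regular integral separated finite-type `k`-scheme `Y`. Stable under further finite
UI surjective covers (composition), unlike regularity. -/
def PicoverChart (k : Type) [Field k] (O : Scheme.{0}) : Prop :=
  ∃ (Y : Scheme.{0}) (fY : Y ⟶ Spec (.of k)) (g : O ⟶ Y), IsSeparated fY ∧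
    LocallyOfFiniteType fY ∧ QuasiCompact fY ∧ IsIntegral Y ∧ Scheme.IsRegular Y ∧
    IsFinite g ∧ UniversallyInjective g ∧ Function.Surjective g.base

/-! ## H0 — calibrations (sorry-free; land first) -/

/-- H0a: the stub in dimension `≤ 3` (Cossart–Piltant 2019). -/
theorem stub_of_dim_le_three (hCP : CossartPiltant2019.{0}) (p : ℕ) (k : Type) [Field k]
    [CharP k p] (Z : Scheme.{0}) (f : Z ⟶ Spec (.of k)) [IsSeparated f] [LocallyOfFiniteType f]
    [QuasiCompact f] [IsIntegral Z] (hdim : topologicalKrullDim Z ≤ 3) : PialtAt Z :=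
  pialtConclusion_of_dim_le_three hCP k Z f hdim

/-- H0b: the stub from resolution in characteristic `p`. -/
theorem stub_of_resolutionInChar (p : ℕ) (h : ResolutionInChar.{0} p) (k : Type) [Field k]
    [CharP k p] (Z : Scheme.{0}) (f : Z ⟶ Spec (.of k)) [IsSeparated f] [LocallyOfFiniteType f]
    [QuasiCompact f] [IsIntegral Z] : PialtAt Z :=
  pialtConclusion_of_hasResolution Z (h k Z f inferInstance inferInstance inferInstance inferInstance)

/-- H0c: the two conjectural atoms of the plan are consequences of `ResolutionInChar p`
(the plan never proves more than the summit; `Picover ⇐ summit` is `PAlterationPicoverOfSummit`). -/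
theorem twoModelPatching_of_resolutionInChar' (p : ℕ) (h : ResolutionInChar.{0} p) :
    ProperModel.TwoModelPatching.{0} p :=
  ProperModel.twoModelPatching_of_resolutionInChar h

/-! ## H1 — finite RR atlas (S) -/

theorem exists_finite_rrAtlas (k : Type) [Field k] (Z : Scheme.{0}) (f : Z ⟶ Spec (.of k))
    [QuasiCompact f]
    (hL : ∀ z : Z, ∃ U : Z.Opens, z ∈ U ∧ RR (U : Scheme.{0})) :
    ∃ (n : ℕ) (U : Fin n → Z.Opens), (⨆ i, U i) = ⊤ ∧ ∀ i, RR (U i : Scheme.{0}) := by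
  sorry

/-! ## H2 — FIELD NORMAL FORM of one chart: extend the RR witness of an open to a global finite
radicial NORMAL cover restricting to it (de Jong 1996, 4.17 / `FiniteCoverCompactification`) (M) -/

theorem exists_finite_radicial_cover_extending (p : ℕ) [Fact p.Prime] (k : Type) [Field k]
    [CharP k p] (Z : Scheme.{0}) [IsIntegral Z] (f : Z ⟶ Spec (.of k)) [LocallyOfFiniteType f]
    (hN : Normal Z) (U : Z.Opens) (W : Scheme.{0}) [IsIntegral W] (w : W ⟶ (U : Scheme.{0}))
    [IsFinite w] [UniversallyInjective w] (hw : Function.Surjective w.base) (hWn : Normal W) :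
    ∃ (Z₁ : Scheme.{0}) (h : Z₁ ⟶ Z) (i : W ⟶ Z₁), IsIntegral Z₁ ∧ Normal Z₁ ∧ IsFinite h ∧
      UniversallyInjective h ∧ Function.Surjective h.base ∧ IsOpenImmersion i ∧
        IsPullback i w h U.ι := by
  sorry

/-! ## H3 — ONE purely inseparable field for all charts (S) -/

theorem exists_common_purelyInseparable_extension (K : Type) [Field K] {n : ℕ}
    (M : Fin n → Type) [∀ i, Field (M i)] [∀ i, Algebra K (M i)]
    [∀ i, FiniteDimensional K (M i)] [∀ i, IsPurelyInseparable K (M i)] :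
    ∃ (L : Type) (_ : Field L) (_ : Algebra K L), FiniteDimensional K L ∧
      IsPurelyInseparable K L ∧ ∀ i, Nonempty (M i →ₐ[K] L) := by
  sorry

/-! ## H4 — DOMINATION: `Z^L` maps onto every intermediate finite radicial cover (M) -/

/-- H4a (pure universal property; generalises `exists_hom_normalizationIn_normalization`): for a
tower `K(Z) ⊆ K(Z₁) ⊆ L` given by an integral dominant `h : Z₁ → Z` and a `K(Z)`-embedding
`e : K(Z₁) → L`, the normalisation `Z^L` maps to `Z₁` over `Z` (`Scheme.Hom.normalizationDesc`
applied to `Spec L → Spec K(Z₁) → Z₁ → Z = Spec L → Spec K(Z) → Z`, naturality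
`specMap_functionFieldMap_comp_fromSpecFunctionField`). -/
theorem exists_hom_normalizationIn_of_algHom (Z : Scheme.{0}) [IsIntegral Z] (L : Type) [Field L]
    [Algebra Z.functionField L] {Z₁ : Scheme.{0}} [IsIntegral Z₁] (h : Z₁ ⟶ Z) [IsIntegralHom h]
    [IsDominant h] (e : FunctionFieldOver h →ₐ[Z.functionField] L) :
    ∃ δ : normalizationIn Z L ⟶ Z₁,
      δ ≫ h = normalizationInι Z L ∧ IsIntegralHom δ ∧ IsDominant δ := by
  sorry

/-- H4b (cancellations: `IsFinite.of_comp`, `universallyInjective_of_comp`,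
`surjective_of_isDominant_of_isClosed_range` — the pattern of `stub_normalizeRR`; UI of the
composite `Z^L → Z` is `universallyInjective_normalizationInι_of_isPurelyInseparable`). -/
theorem exists_finite_universallyInjective_hom_normalizationIn (p : ℕ) [Fact p.Prime] (k : Type)
    [Field k] [CharP k p] (Z : Scheme.{0}) [IsIntegral Z] (f : Z ⟶ Spec (.of k))
    [LocallyOfFiniteType f] (hN : Normal Z) (L : Type) [Field L] [Algebra Z.functionField L]
    [FiniteDimensional Z.functionField L] [IsPurelyInseparable Z.functionField L]
    {Z₁ : Scheme.{0}} [IsIntegral Z₁] (h : Z₁ ⟶ Z) [IsFinite h] [IsDominant h]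
    (e : FunctionFieldOver h →ₐ[Z.functionField] L) :
    ∃ δ : normalizationIn Z L ⟶ Z₁, δ ≫ h = normalizationInι Z L ∧ IsFinite δ ∧
      UniversallyInjective δ ∧ Function.Surjective δ.base := by
  sorry

/-! ## H6 — the Picover atlas of `Z^L` (assembles H1–H4; M) -/

theorem exists_normalizationIn_forall_picoverChart (p : ℕ) [Fact p.Prime] (k : Type) [Field k]
    [CharP k p] (Z : Scheme.{0}) [IsIntegral Z] (f : Z ⟶ Spec (.of k)) [IsSeparated f]
    [LocallyOfFiniteType f] [QuasiCompact f] (hN : Normal Z)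
    (hL : ∀ z : Z, ∃ U : Z.Opens, z ∈ U ∧ RR (U : Scheme.{0})) :
    ∃ (L : Type) (_ : Field L) (_ : Algebra Z.functionField L),
      FiniteDimensional Z.functionField L ∧ IsPurelyInseparable Z.functionField L ∧
      ∀ y : normalizationIn Z L, ∃ O : (normalizationIn Z L).Opens, y ∈ O ∧
        PicoverChart k (O : Scheme.{0}) := by
  sorry

/-! ## H5 — ZARISKI-LOCALITY OF WEAK RESOLUTION modulo two-model patching + Nagata (L; the engine)
Template: `sandwichedWeakResolution_of_twoModelPatching` (compactify, `ProperModel.ofChart`,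
`ProperModel.exists_extension_of_nagata` per chart, patch with `RegLe`, restrict over `V`). -/

theorem hasResolution_of_forall_exists_open_hasResolution {p : ℕ} (hNag : NagataCompactification.{0})
    (hT : ProperModel.TwoModelPatching.{0} p) (k : Type) [Field k] [CharP k p]
    (V : Scheme.{0}) [IsIntegral V] (f : V ⟶ Spec (.of k)) [IsSeparated f]
    [LocallyOfFiniteType f] [QuasiCompact f]
    (hloc : ∀ v : V, ∃ U : V.Opens, v ∈ U ∧ Scheme.HasResolution (U : Scheme.{0})) :
    Scheme.HasResolution V := by
  sorry

/-- H5-aux: the multi-model patch (list induction with `RegLe`, cf. `exists_hom_forall_regCentre`). -/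
theorem exists_hom_forall_regLe {k K : Type} [Field k] [Field K] [Algebra k K]
    (hZ : ∀ M₁ M₂ : ProperModel k K,
      ∃ (N : ProperModel k K) (φ₁ : N.Hom M₁) (φ₂ : N.Hom M₂), φ₁.RegLe ∧ φ₂.RegLe)
    (M₀ : ProperModel k K) (l : List (ProperModel k K)) :
    ∃ (N : ProperModel k K) (ψ : N.Hom M₀), ψ.RegLe ∧
      ∀ M ∈ l, ∃ χ : N.Hom M, χ.RegLe := by
  sorry

/-! ## ASSEMBLY (sorry-free modulo H5, H6): the stub from `Picover ∧ TwoModelPatching p ∧ Nagata`.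
Perfectness of `k` is NOT used. -/

theorem stub_radicialPatching_of_atoms (hPc : Picover) (hNag : NagataCompactification.{0})
    (p : ℕ) (hp : p.Prime) (hT : ProperModel.TwoModelPatching.{0} p) (k : Type) [Field k]
    [CharP k p] (Z : Scheme.{0}) (f : Z ⟶ Spec (.of k)) [IsSeparated f] [LocallyOfFiniteType f]
    [QuasiCompact f] [IsIntegral Z] (hN : ∀ z : Z, IsIntegrallyClosed (Z.presheaf.stalk z))
    (hL : ∀ z : Z, ∃ U : Z.Opens, z ∈ U ∧ ∃ (W : Scheme.{0}) (h : W ⟶ (U : Scheme.{0})),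
      IsIntegral W ∧ Scheme.IsRegular W ∧ IsFinite h ∧ UniversallyInjective h ∧
        Function.Surjective h.base) :
    ∃ (Z' : Scheme.{0}) (g : Z' ⟶ Z), IsProper g ∧ IsIntegral Z' ∧ Scheme.IsRegular Z' ∧
      Function.Surjective g.base ∧ ∃ U : Z.Opens, Dense (U : Set Z) ∧ IsFinite (g ∣_ U) ∧
        UniversallyInjective (g ∣_ U) := by
  haveI : Fact p.Prime := ⟨hp⟩
  obtain ⟨L, _, _, hfd, hpi, hcharts⟩ :=
    exists_normalizationIn_forall_picoverChart p k Z f hN hL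
  haveI := hfd
  haveI := hpi
  -- `Z^L` is integral, finite over `Z`, hence separated / finite type / quasi-compact over `k`
  haveI : IsFinite (normalizationInι Z L) := isFinite_normalizationInι Z L f
  haveI : IsSeparated (normalizationInι Z L ≫ f) := inferInstance
  haveI : LocallyOfFiniteType (normalizationInι Z L ≫ f) := inferInstance
  haveI : QuasiCompact (normalizationInι Z L ≫ f) := inferInstance
  -- every point of `Z^L` has a resolvable open neighbourhood (Picover on the chart)
  have hloc : ∀ y : normalizationIn Z L, ∃ O : (normalizationIn Z L).Opens, y ∈ O ∧
      Scheme.HasResolution (O : Scheme.{0}) := by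
    intro y
    obtain ⟨O, hy, Y, fY, g, hs, hl, hq, hY, hreg, hfin, hui, hsurj⟩ := hcharts y
    haveI : Nonempty (O : Scheme.{0}) := ⟨⟨y, hy⟩⟩
    haveI : IsIntegral (O : Scheme.{0}) := isIntegral_of_isOpenImmersion O.ι
    exact ⟨O, hy, hPc p hp k Y O fY g hs hl hq hY hreg inferInstance hfin hui hsurj⟩
  have hres : Scheme.HasResolution (normalizationIn Z L) :=
    hasResolution_of_forall_exists_open_hasResolution hNag hT k (normalizationIn Z L)
      (normalizationInι Z L ≫ f) hloc
  exact pialtConclusion_of_hasResolution_normalizationIn hp k Z f hN L hres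

/-- Sanity: the assembly has literally the stub's type (with the three atoms in front). -/
example (hPc : Picover) (hNag : NagataCompactification.{0})
    (hT : ∀ p : ℕ, p.Prime → ProperModel.TwoModelPatching.{0} p)
    (p : ℕ) (hp : p.Prime) (k : Type) [Field k] [CharP k p]
    [PerfectField k] (Z : Scheme.{0}) (f : Z ⟶ Spec (.of k)) [IsSeparated f]
    [LocallyOfFiniteType f] [QuasiCompact f] [IsIntegral Z]
    (hN : ∀ z : Z, IsIntegrallyClosed (Z.presheaf.stalk z))
    (hL : ∀ z : Z, ∃ U : Z.Opens, z ∈ U ∧ ∃ (W : Scheme.{0}) (h : W ⟶ (U : Scheme.{0})),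
      IsIntegral W ∧ Scheme.IsRegular W ∧ IsFinite h ∧ UniversallyInjective h ∧
        Function.Surjective h.base) :
    ∃ (Z' : Scheme.{0}) (g : Z' ⟶ Z), IsProper g ∧ IsIntegral Z' ∧ Scheme.IsRegular Z' ∧
      Function.Surjective g.base ∧ ∃ U : Z.Opens, Dense (U : Set Z) ∧ IsFinite (g ∣_ U) ∧
        UniversallyInjective (g ∣_ U) :=
  stub_radicialPatching_of_atoms hPc hNag p hp (hT p hp) k Z f hN hL

/-! ## FALLBACK F1 — field-free globalisation (iterated normalisation + RR stability, perfect `k`) -/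

/-- F1: over a PERFECT field, a normal LRR `Z` has a finite radicial cover `Z'' → Z`, `Z''` integral
normal, covered by Picover charts (induction on a finite RR atlas: H2 on one chart, RR stability
`stub_rr_of_finite_universallyInjective` on the others, Picover charts pull back by composition). -/
theorem exists_radicialCover_forall_picoverChart (p : ℕ) (hp : p.Prime) (k : Type) [Field k]
    [CharP k p] [PerfectField k] (Z : Scheme.{0}) [IsIntegral Z] (f : Z ⟶ Spec (.of k))
    [IsSeparated f] [LocallyOfFiniteType f] [QuasiCompact f] (hN : Normal Z)
    (hL : ∀ z : Z, ∃ U : Z.Opens, z ∈ U ∧ RR (U : Scheme.{0})) :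
    ∃ (Z'' : Scheme.{0}) (c : Z'' ⟶ Z), IsIntegral Z'' ∧ Normal Z'' ∧ IsFinite c ∧
      UniversallyInjective c ∧ Function.Surjective c.base ∧
      ∀ y : Z'', ∃ O : Z''.Opens, y ∈ O ∧ PicoverChart k (O : Scheme.{0}) := by
  sorry

/-- F1-assembly (sorry-free modulo F1 and H5). -/
theorem stub_radicialPatching_of_atoms' (hPc : Picover) (hNag : NagataCompactification.{0})
    (p : ℕ) (hp : p.Prime) (hT : ProperModel.TwoModelPatching.{0} p) (k : Type) [Field k]
    [CharP k p] [PerfectField k] (Z : Scheme.{0}) (f : Z ⟶ Spec (.of k)) [IsSeparated f]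
    [LocallyOfFiniteType f] [QuasiCompact f] [IsIntegral Z]
    (hN : ∀ z : Z, IsIntegrallyClosed (Z.presheaf.stalk z))
    (hL : ∀ z : Z, ∃ U : Z.Opens, z ∈ U ∧ ∃ (W : Scheme.{0}) (h : W ⟶ (U : Scheme.{0})),
      IsIntegral W ∧ Scheme.IsRegular W ∧ IsFinite h ∧ UniversallyInjective h ∧
        Function.Surjective h.base) :
    ∃ (Z' : Scheme.{0}) (g : Z' ⟶ Z), IsProper g ∧ IsIntegral Z' ∧ Scheme.IsRegular Z' ∧
      Function.Surjective g.base ∧ ∃ U : Z.Opens, Dense (U : Set Z) ∧ IsFinite (g ∣_ U) ∧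
        UniversallyInjective (g ∣_ U) := by
  obtain ⟨Z'', c, hZ'', hZ''n, hfin, hui, hsurj, hcharts⟩ :=
    exists_radicialCover_forall_picoverChart p hp k Z f hN hL
  haveI := hZ''; haveI := hfin; haveI := hui
  haveI : Surjective c := ⟨hsurj⟩
  haveI : IsSeparated (c ≫ f) := inferInstance
  haveI : LocallyOfFiniteType (c ≫ f) := inferInstance
  haveI : QuasiCompact (c ≫ f) := inferInstance
  have hloc : ∀ y : Z'', ∃ O : Z''.Opens, y ∈ O ∧ Scheme.HasResolution (O : Scheme.{0}) := by
    intro y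
    obtain ⟨O, hy, Y, fY, g, hs, hl, hq, hY, hreg, hfin', hui', hsurj'⟩ := hcharts y
    haveI : Nonempty (O : Scheme.{0}) := ⟨⟨y, hy⟩⟩
    haveI : IsIntegral (O : Scheme.{0}) := isIntegral_of_isOpenImmersion O.ι
    exact ⟨O, hy, hPc p hp k Y O fY g hs hl hq hY hreg inferInstance hfin' hui' hsurj'⟩
  have hres : Scheme.HasResolution Z'' :=
    hasResolution_of_forall_exists_open_hasResolution hNag hT k Z'' (c ≫ f) hloc
  exact pialtConclusion_of_finite_universallyInjective_surjective c
    (pialtConclusion_of_hasResolution Z'' hres)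

end Summit.ResolutionOfSingularities.ResolutionOfSingularities.Cruxes.Pialt.StubPlanRadicialPatching

end
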